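import Literature.MathematicalPhysics.QuantumFieldTheory.Balaban1983to89.B9Cor36CutoffField337

/-!
# `Balaban1983to89.B9Eq337CutFieldDirY` — [Balaban1985BackgroundPropagators] Cor. 3.6 p. 408, THE STEP «Uᵘ = e^{iηA} satisfies (3.37) for the sequence {Ω_n(□)}
# with U = 1 and α₁ = O(1)Mα₀» ON ROAD P4 (print's Dirichlet cube letter): THE SMALL FIELD `Ṽ := Uᵘ` ON THE BONDS INSIDE `Ω₀(□)`, `1` ELSEWHERE — `Ṽ = e^{iηÃ}·1`,
# `Ã = A·𝟙[bond ⊂ Ω₀(□)]` — AND ITS FIVE (3.37)-READINGS IN THE SHAPES OF `B9Thm34SectBUniformR1.thm34_Gp_uniform` (`α₁ := 2CΛ²`), the jumps of the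
# indicator being charged to the level-`0` rows where they sit (print's collars p. 408) — sub-row G-B9-LETTERS (site sector), seat dag-n06-c g32 UNIT 5

statement-level skeleton of published theorems with citation tags; proofs where landed; nothing here is a claim about the Yang–Mills mass gap

CITATION HEADER (lean-in-tree rule).  B9 = T. Bałaban, *Propagators for lattice gauge theories in a background field*, Commun. Math. Phys. **99** (1985)
389–434 [Balaban1985BackgroundPropagators] (held `paper:balaban1985-cmp99-background-propagators`; journal page = PDF page + 388): p. 408 l. 1–6 «Applying the
gauge transformation u we get U′ = Uᵘ = e^{iηA} with A satisfying the inequalities in (3.35) … This implies that U′ satisfies (3.37) for the sequence {Ω_j} with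
U = 1 and α₁ = O(1)Mα₀»; p. 408 (last lines) «dist(Ω_n(□)ᶜ, Ω_{n+1}(□)) = 2R₀M₀Lⁿη … For n ≧ 0 we have dist(Ω₀(□)ᶜ, □⁴) < 2R₀M₀Lʲη, hence Ω₀(□) ⊂ □⁵»;
p. 394 l. 24–33 «They depend on the configuration U restricted to Ω₀»; (3.37) p. 396 «|A′| < α₁(Lʲη)⁻¹, |∇^η_U A′| < α₁(Lʲη)⁻² … on Ω_j»; (3.35) p. 396; (3.3)
p. 390, (3.8) p. 392, (3.50) p. 400 (`τ`); Thm 3.4 p. 400.  Rows B9.Cor3.6 × B9.(3.37) (cells only; no row head changes).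

WHY THIS FILE (road P4 of the N06 h36b campaign; UNITS 1–4 of this seat).  Print's Cor. 3.6 estimates `G′_□(U)` by Cor. 3.5 at the small field `Uᵘ = e^{iηA}` on
`Ω₀(□)` and gauge invariance.  The Dirichlet letter reads `U` only on the bonds INSIDE `Ω₀(□)` (UNIT 6 `padDeltaCubeY_congr_of_agree_inside`), so the honest small
field of the road is `Ṽ := Uᵘ` there and `1` on every other bond — a product field `e^{iηÃ}·1` with the CUT POTENTIAL `Ã = A·𝟙[bond ⊂ Ω₀(□)]` (§1), for which
(a) the variation `Δ′_{a,□}(1) − Δ′_{a,□}(Ṽ)` is compressed by `Ω₀(□)` (UNIT 6) and (b) `padΔ_{□,Ω₀}(Ṽ) = padΔ_{□,Ω₀}(Uᵘ)` (UNIT 6).  Theorem 3.4's engine then wants the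
five (3.37)-readings of `Ã` at the cube lengths `L^{lev_□}η`; §2 proves them from the datum `|A| ≤ Cξ⁻¹`, `|η⁻¹∂A| ≤ Cξ⁻²` with `α₁ := 2CΛ²`: inside, `Ã = A`; the
indicator's jumps (size `Cξ⁻¹η⁻¹`) occur only within two steps of `∂Ω₀(□)`, i.e. on rows of cube level `0` (the displayed GEOMETRY `hS2`: every positive-level row
has its 2-step stencil in `Ω₀(□)` — print's collars), where the allowance is `α₁η⁻²`.  r05's smooth-cutoff lemma `B9Cor36CutoffField337.readings337_cutA` (site
cutoff `χ`, gradient `g`) would charge the jump against `ξ⁻²` uniformly and is not used; its `U = 1` calculus (`covD_one_apply`, …, `inv_scale_le`) is.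

WHAT IS PROVED (3 `def`s with bodies — `cutFldS`, `cutCfgS`, `cutAc`; 0 sorry; 0 new named facts; standard axioms):
* §1 `cutFldS`, `cutCfgS`, `cutAc`, `chartA_cutFldS`, `cutAc_apply_of`, `fluct_congr_apply`, `fluct_eq_one_of_apply_eq_zero`, `boxEquiv_shift`, ★`UboxY_cutCfgS`
  (`Ṽ_μ(z) = e^{iηA_μ(z)}` on a bond inside `S`, `1` otherwise), `UboxY_cutCfgS_of_not`, ★`UboxY_cutCfgS_of_mem` (`= Uᵘ` there, from the datum on `Q ⊇ chart⁻¹S`);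
* §2 ★★★`readings337_cutAc` (chart form) ∕ ★★`readings337_cutFldS` (V1 datum form): the five readings `h337B`, `h337F`, `h337Bτ` (`α₁(len²)⁻¹`), `hA`, `hAτB`
  (`α₁len⁻¹`) with `α₁ := 2CΛ²`, hypotheses `η ≤ len ≤ Λξ` and `hS2`.

PROOF.  Ours (bookkeeping); case split per row on `η < len z`.

HONEST SCOPE / NOT CLAIMED.  The geometry `hS2` and the datum box are DISPLAYED (their supply from g31's mirror box and from the member's `Reg335` class are separate
units); base `U = 1`; nothing on `d = 4`, the continuum, reflection positivity or the mass gap; NOT a node discharge; no row head changes.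

RELATED IN THE TREE, NOT DUPLICATED: r05's `B9Cor36CutoffField337` ∕ `B9Cor36CubeCutoffs.readings337_locFld` (smooth site cutoff `χ̃_□`, design (R)); def-Y's E
(`padDeltaCubeY`/`GpDirY`), consumed downstream.
-/

noncomputable section

namespace Literature.MathematicalPhysics.QuantumFieldTheory.Balaban1983to89.B9Eq337CutFieldDirY

open Literature.MathematicalPhysics.QuantumFieldTheory.Balaban1983to89
open Literature.MathematicalPhysics.QuantumFieldTheory.Balaban1983to89.B9Eq39Adjoint (R fluct covD covDstar)
open Literature.MathematicalPhysics.QuantumFieldTheory.Balaban1983to89.B9Eq352DivForm (tauB)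
open Literature.MathematicalPhysics.QuantumFieldTheory.Balaban1983to89.B6KLevelCensusIndexV1 (KIdx)
open Literature.MathematicalPhysics.QuantumFieldTheory.Balaban1983to89.B6GlobalChartV1 (PV boxEquiv boxEquiv_apply toBox)
open Literature.MathematicalPhysics.QuantumFieldTheory.Balaban1983to89.B9Eq360DeltaPrimeAY (mulY AfldY chartA chartA_apply)
open Literature.MathematicalPhysics.QuantumFieldTheory.Balaban1983to89.B9Eq37Insertion (holU val_holU)
open Literature.MathematicalPhysics.QuantumFieldTheory.Balaban1983to89.Beta.TransportVertices (holonomy holonomy_cons holonomy_nil)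
open Literature.MathematicalPhysics.QuantumFieldTheory.Balaban1983to89.B9Cor36CutoffField337 (covD_one_apply covDstar_one_apply tauB_one_apply inv_scale_le)
open Literature.MathematicalPhysics.QuantumFieldTheory.Balaban1983to89.Node00 (SiteY CfgY GaugeY toKT shiftY UboxY gaugeY)
open Literature.MathematicalPhysics.QuantumFieldTheory.Balaban1983to89.B9BackgroundsKLevelV1 (shiftsV1)

variable {d ℓ : ℕ} {hd : 1 ≤ d + 1} {hL : Odd (ℓ + 1) ∧ 1 < ℓ + 1} {b₀ b₁ : ℝ}
variable {𝔸 : Type} [NormedRing 𝔸] [NormedAlgebra ℂ 𝔸] [CompleteSpace 𝔸]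
variable (i : KIdx d ℓ hd hL b₀ b₁)

/-! ## §1  The cut potential `Ã = A·𝟙[bond ⊂ S]` and the small field `Ṽ = e^{iηÃ}·1` -/

section Letters

open Classical in
/-- **THE CUT POTENTIAL `Ã := A·𝟙[bond ⊂ S]`**: the gauge-fixed potential of the (3.35) datum kept on the bonds with both endpoints in `S = Ω₀(□)`, zero elsewhere
(print: `U′ = Uᵘ = e^{iηA}` on `Ω₀(□) ⊂ □⁵`, p. 408; the Dirichlet letter reads nothing else, p. 394). [cite: Balaban1985BackgroundPropagators, p.408 («Applying the gauge transformation u we get U′ = Uᵘ = e^{iηA}»), p.394 («restricted to Ω₀»)] -/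
def cutFldS (S : Finset (SiteY i)) (A : AfldY 𝔸 i) : AfldY 𝔸 i :=
  fun μ x => if boxEquiv i.hN x ∈ S ∧ shiftY i μ (boxEquiv i.hN x) ∈ S then A μ x else 0

/-- **THE SMALL FIELD `Ṽ = e^{iηÃ}·1`** of road P4 at the cube. [cite: Balaban1985BackgroundPropagators, p.408, Cor. 3.5 p.407 («U′ satisfying (3.37) … with U = 1»)] -/
def cutCfgS (S : Finset (SiteY i)) (η : ℝ) (A : AfldY 𝔸 i) : CfgY 𝔸 i := mulY i (fluct η (cutFldS i S A)) (fun _ _ => 1)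

open Classical in
/-- **THE CUT POTENTIAL ON THE CHART**: `Ã(κ, z) = A(κ, chart⁻¹z)` on a bond inside `S`, `0` otherwise. [cite: Balaban1985BackgroundPropagators, (3.37) p.396, p.408, dictionary] -/
def cutAc (S : Finset (SiteY i)) (Ac : Fin (d + 1) → SiteY i → 𝔸) : Fin (d + 1) → SiteY i → 𝔸 :=
  fun κ z => if z ∈ S ∧ shiftY i κ z ∈ S then Ac κ z else 0

omit [NormedAlgebra ℂ 𝔸] [CompleteSpace 𝔸] in
/-- the chart reading of `Ã` IS the cut of the chart reading of `A`. [cite: Balaban1985BackgroundPropagators, (3.37) p.396, dictionary] -/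
theorem chartA_cutFldS (S : Finset (SiteY i)) (A : AfldY 𝔸 i) : chartA i (cutFldS i S A) = cutAc i S (chartA i A) := by
  funext κ z
  rw [chartA_apply, cutFldS, cutAc, chartA_apply, Equiv.apply_symm_apply]
  split_ifs with h1 h2 h2
  · rfl
  · exact absurd h1 h2
  · exact absurd h2 h1
  · rfl

omit [NormedAlgebra ℂ 𝔸] [CompleteSpace 𝔸] in
/-- `Ã` vanishes off the bonds inside `S` and equals `A` on them. [cite: Balaban1985BackgroundPropagators, p.394, bookkeeping] -/
theorem cutAc_apply_of (S : Finset (SiteY i)) (Ac : Fin (d + 1) → SiteY i → 𝔸) (κ : Fin (d + 1)) (z : SiteY i) :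
    (z ∈ S ∧ shiftY i κ z ∈ S → cutAc i S Ac κ z = Ac κ z) ∧ (¬ (z ∈ S ∧ shiftY i κ z ∈ S) → cutAc i S Ac κ z = 0) :=
  ⟨fun h => if_pos h, fun h => if_neg h⟩

/-- `e^{iη·a}` depends on the value `a` only. [cite: Balaban1985BackgroundPropagators, p.390 («U′ = exp iηA′»), bookkeeping] -/
theorem fluct_congr_apply {η : ℝ} {A A' : AfldY 𝔸 i} {μ : Fin (d + 1)} {x : Site (PV d ℓ i.m i.K hd hL) 0} (h : A μ x = A' μ x) :
    fluct η A μ x = fluct η A' μ x := by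
  show holU [((Complex.I * η : ℂ)) • A μ x] = holU [((Complex.I * η : ℂ)) • A' μ x]
  rw [h]

/-- `e^{iη·0} = 1`. [cite: Balaban1985BackgroundPropagators, p.390, bookkeeping] -/
theorem fluct_eq_one_of_apply_eq_zero {η : ℝ} {A : AfldY 𝔸 i} {μ : Fin (d + 1)} {x : Site (PV d ℓ i.m i.K hd hL) 0} (h : A μ x = 0) :
    fluct η A μ x = 1 := by
  apply Units.ext
  rw [fluct, val_holU, holonomy_cons, holonomy_nil, mul_one, h, smul_zero, NormedSpace.exp_zero, Units.val_one]

omit [NormedRing 𝔸] [NormedAlgebra ℂ 𝔸] [CompleteSpace 𝔸] in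
/-- the chart takes `x.shift μ` to `shiftY μ`. [cite: Balaban1984PropagatorsII, (2.1) p.224, dictionary] -/
theorem boxEquiv_shift (x : Site (PV d ℓ i.m i.K hd hL) 0) (μ : Fin (d + 1)) : boxEquiv i.hN (x.shift μ) = shiftY i μ (boxEquiv i.hN x) := by
  rw [boxEquiv_apply, boxEquiv_apply, B6ScalarChartV1.toBox_shift]; rfl

/-- ★ **THE BOND VARIABLES OF `Ṽ`**: `Ṽ_μ(z) = e^{iηA_μ(z)}` on a bond inside `S`, `1` on every other bond. [cite: Balaban1985BackgroundPropagators, p.408, p.394] -/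
theorem UboxY_cutCfgS (S : Finset (SiteY i)) (η : ℝ) (A : AfldY 𝔸 i) (μ : Fin (d + 1)) (z : SiteY i) :
    UboxY i (cutCfgS i S η A) μ z = if z ∈ S ∧ shiftY i μ z ∈ S then fluct η A μ ((boxEquiv i.hN).symm z) else 1 := by
  have hx : boxEquiv i.hN ((boxEquiv i.hN).symm z) = z := Equiv.apply_symm_apply _ _
  show fluct η (cutFldS i S A) μ ((boxEquiv i.hN).symm z) * 1 = _
  rw [mul_one]
  split_ifs with h
  · exact fluct_congr_apply i (by unfold cutFldS; rw [hx]; exact if_pos h)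
  · exact fluct_eq_one_of_apply_eq_zero i (by unfold cutFldS; rw [hx]; exact if_neg h)

/-- off the bonds inside `S`, `Ṽ` is trivial. [cite: Balaban1985BackgroundPropagators, p.394 («restricted to Ω₀»), bookkeeping] -/
theorem UboxY_cutCfgS_of_not {S : Finset (SiteY i)} (η : ℝ) (A : AfldY 𝔸 i) {μ : Fin (d + 1)} {z : SiteY i} (h : ¬ (z ∈ S ∧ shiftY i μ z ∈ S)) :
    UboxY i (fun _ _ => (1 : 𝔸ˣ)) μ z = UboxY i (cutCfgS i S η A) μ z := by
  rw [UboxY_cutCfgS, if_neg h]; rfl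

/-- ★ **ON THE BONDS INSIDE `S`, `Ṽ` IS `Uᵘ`** — the (3.35) datum `Uᵘ = e^{iηA}` on the bonds of a set `Q` containing the chart preimage of `S`.
[cite: Balaban1985BackgroundPropagators, (3.35) p.396, p.408 («U′ = Uᵘ = e^{iηA}»)] -/
theorem UboxY_cutCfgS_of_mem {S : Finset (SiteY i)} {η : ℝ} {A : AfldY 𝔸 i} {g : GaugeY 𝔸 i} {U : CfgY 𝔸 i} {Q : Set (Site (PV d ℓ i.m i.K hd hL) 0)}
    (hQ : ∀ z ∈ S, (boxEquiv i.hN).symm z ∈ Q)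
    (hgA : ∀ (κ : Fin (d + 1)) (x : Site (PV d ℓ i.m i.K hd hL) 0), x ∈ Q → x.shift κ ∈ Q → gaugeY i g U κ x = fluct η A κ x)
    {μ : Fin (d + 1)} {z : SiteY i} (hz : z ∈ S) (hz' : shiftY i μ z ∈ S) :
    UboxY i (cutCfgS i S η A) μ z = UboxY i (gaugeY i g U) μ z := by
  rw [UboxY_cutCfgS, if_pos ⟨hz, hz'⟩]
  have hsh : ((boxEquiv i.hN).symm z).shift μ = (boxEquiv i.hN).symm (shiftY i μ z) := by
    rw [Equiv.eq_symm_apply, boxEquiv_shift, Equiv.apply_symm_apply]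
  show fluct η A μ ((boxEquiv i.hN).symm z) = gaugeY i g U μ ((boxEquiv i.hN).symm z)
  rw [hgA μ _ (hQ z hz) (by rw [hsh]; exact hQ _ hz')]

end Letters

/-! ## §2  The five (3.37) readings of the cut potential at the cube lengths: jumps only on the level-`0` rows -/

section Readings

omit [CompleteSpace 𝔸] in
/-- ★★★ **THE FIVE (3.37)-READINGS OF `thm34_Gp_uniform` FOR THE CUT POTENTIAL `Ã = A·𝟙[bond ⊂ S]` AT THE BASE `1`** — `hA`, `hAτB` with `α₁·len⁻¹` and `h337F`, `h337B`,
`h337Bτ` with `α₁·(len²)⁻¹`, `α₁ := 2CΛ²`: from `|A| ≤ Cξ⁻¹`, `|η⁻¹∂A| ≤ Cξ⁻²` on the sites of `S` (the (3.35) datum read on the chart), a length function with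
`η ≤ len ≤ Λξ`, and the GEOMETRY «every row of length `> η` (positive cube level) has its whole 2-step stencil in `S`» — so the jumps of the indicator (size `Cξ⁻¹η⁻¹`)
happen only on level-`0` rows, where the allowed size is `α₁η⁻²` (print places `∂Ω₀(□)` in `Λ₀` territory: `dist(Ω₀(□)ᶜ, Ω₁(□)) = 2R₀M₀η`, p. 408).
[cite: Balaban1985BackgroundPropagators, (3.37) p.396, Cor. 3.6 p.408 («Uᵘ satisfies (3.37) for the sequence … with U = 1 and α₁ = O(1)Mα₀»), p.408 (the collars of Ω_n(□)), Thm 3.4 p.400] -/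
theorem readings337_cutAc {S : Finset (SiteY i)} {Ac : Fin (d + 1) → SiteY i → 𝔸} {C η ξ Λ : ℝ} (hC : 0 ≤ C) (hη : 0 < η) (hξ : η ≤ ξ) (hΛ : 1 ≤ Λ)
    (hA : ∀ κ z, z ∈ S → ‖Ac κ z‖ ≤ C * ξ⁻¹)
    (hdA : ∀ μ ν z, z ∈ S → shiftY i μ z ∈ S → ‖((η : ℂ)⁻¹) • (Ac ν (shiftY i μ z) - Ac ν z)‖ ≤ C * (ξ ^ 2)⁻¹)
    (len : SiteY i → ℝ) (hlenη : ∀ z, η ≤ len z) (hlenΛ : ∀ z, len z ≤ Λ * ξ)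
    (hS2 : ∀ z, η < len z → z ∈ S ∧ ∀ μ, shiftY i μ z ∈ S ∧ (shiftY i μ).symm z ∈ S ∧
      ∀ ν, shiftY i ν (shiftY i μ z) ∈ S ∧ shiftY i ν ((shiftY i μ).symm z) ∈ S ∧ (shiftY i ν).symm ((shiftY i μ).symm z) ∈ S) :
    (∀ ν κ z, ‖((η : ℂ)⁻¹) • covDstar (shiftY i) (fun _ _ => (1 : 𝔸ˣ)) ν (cutAc i S Ac κ) z‖ ≤ 2 * C * Λ ^ 2 * (len z ^ 2)⁻¹) ∧
    (∀ μ ν z, ‖((η : ℂ)⁻¹) • covD (shiftY i) (fun _ _ => (1 : 𝔸ˣ)) μ (cutAc i S Ac ν) z‖ ≤ 2 * C * Λ ^ 2 * (len z ^ 2)⁻¹) ∧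
    (∀ μ z, ‖((η : ℂ)⁻¹) • covDstar (shiftY i) (fun _ _ => (1 : 𝔸ˣ)) μ (tauB (shiftY i) (fun _ _ => (1 : 𝔸ˣ)) μ (cutAc i S Ac μ)) z‖ ≤
      2 * C * Λ ^ 2 * (len z ^ 2)⁻¹) ∧
    (∀ κ z, ‖cutAc i S Ac κ z‖ ≤ 2 * C * Λ ^ 2 * (len z)⁻¹) ∧
    (∀ ν κ z, ‖tauB (shiftY i) (fun _ _ => (1 : 𝔸ˣ)) ν (cutAc i S Ac κ) z‖ ≤ 2 * C * Λ ^ 2 * (len z)⁻¹) := by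
  have hξ0 : 0 < ξ := hη.trans_le hξ
  have hΛ0 : 0 ≤ Λ := zero_le_one.trans hΛ
  have hlen : ∀ z, 0 < len z := fun z => hη.trans_le (hlenη z)
  have hηabs : ‖((η : ℂ)⁻¹)‖ = η⁻¹ := by rw [norm_inv, Complex.norm_real, Real.norm_of_nonneg hη.le]
  -- the uniform value bound `‖Ã‖ ≤ Cξ⁻¹`
  have hval : ∀ κ w, ‖cutAc i S Ac κ w‖ ≤ C * ξ⁻¹ := fun κ w => by
    by_cases h : w ∈ S ∧ shiftY i κ w ∈ S
    · rw [(cutAc_apply_of i S Ac κ w).1 h]; exact hA κ w h.1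
    · rw [(cutAc_apply_of i S Ac κ w).2 h, norm_zero]; positivity
  -- scale conversions
  have conv1 : ∀ z, C * ξ⁻¹ ≤ 2 * C * Λ ^ 2 * (len z)⁻¹ := fun z => by
    obtain ⟨h1, -⟩ := inv_scale_le hξ0 (hlen z) (hlenΛ z)
    have hΛ1 : Λ ≤ 2 * Λ ^ 2 := by nlinarith
    calc C * ξ⁻¹ ≤ C * (Λ * (len z)⁻¹) := mul_le_mul_of_nonneg_left h1 hC
      _ ≤ C * (2 * Λ ^ 2 * (len z)⁻¹) := mul_le_mul_of_nonneg_left (mul_le_mul_of_nonneg_right hΛ1 (inv_nonneg.2 (hlen z).le)) hC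
      _ = 2 * C * Λ ^ 2 * (len z)⁻¹ := by ring
  have conv2 : ∀ z, C * (ξ ^ 2)⁻¹ ≤ 2 * C * Λ ^ 2 * (len z ^ 2)⁻¹ := fun z => by
    obtain ⟨-, h2⟩ := inv_scale_le hξ0 (hlen z) (hlenΛ z)
    calc C * (ξ ^ 2)⁻¹ ≤ C * (Λ ^ 2 * (len z ^ 2)⁻¹) := mul_le_mul_of_nonneg_left h2 hC
      _ ≤ 2 * C * Λ ^ 2 * (len z ^ 2)⁻¹ := by
          have : 0 ≤ C * (Λ ^ 2 * (len z ^ 2)⁻¹) := by positivity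
          linarith
  -- the crude derivative bound on a level-`0` row: `2Cη⁻¹ξ⁻¹ ≤ 2CΛ²η⁻²`
  have crude : ∀ (z : SiteY i) (X Y : 𝔸), ¬ η < len z → ‖X‖ ≤ C * ξ⁻¹ → ‖Y‖ ≤ C * ξ⁻¹ →
      ‖((η : ℂ)⁻¹) • (X - Y)‖ ≤ 2 * C * Λ ^ 2 * (len z ^ 2)⁻¹ := by
    intro z X Y hz hX hY
    have hlz : len z = η := le_antisymm (not_lt.1 hz) (hlenη z)
    rw [norm_smul, hηabs, hlz]
    have hXY : ‖X - Y‖ ≤ 2 * (C * ξ⁻¹) := (norm_sub_le _ _).trans (by linarith)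
    have hξη : ξ⁻¹ ≤ η⁻¹ := inv_anti₀ hη hξ
    have hΛ2 : (1 : ℝ) ≤ Λ ^ 2 := one_le_pow₀ hΛ
    calc η⁻¹ * ‖X - Y‖ ≤ η⁻¹ * (2 * (C * ξ⁻¹)) := mul_le_mul_of_nonneg_left hXY (inv_nonneg.2 hη.le)
      _ ≤ η⁻¹ * (2 * (C * η⁻¹)) := by gcongr
      _ = 2 * C * 1 * (η ^ 2)⁻¹ := by rw [sq, mul_inv]; ring
      _ ≤ 2 * C * Λ ^ 2 * (η ^ 2)⁻¹ := by gcongr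
  -- the datum's derivative bound on a row whose two bonds are inside `S`, in either orientation
  have fine : ∀ (μ ν : Fin (d + 1)) (w z : SiteY i), w ∈ S → shiftY i μ w ∈ S → shiftY i ν w ∈ S → shiftY i ν (shiftY i μ w) ∈ S →
      ‖((η : ℂ)⁻¹) • (cutAc i S Ac ν (shiftY i μ w) - cutAc i S Ac ν w)‖ ≤ C * (ξ ^ 2)⁻¹ := by
    intro μ ν w z hw hμw hνw hνμw
    rw [(cutAc_apply_of i S Ac ν (shiftY i μ w)).1 ⟨hμw, hνμw⟩, (cutAc_apply_of i S Ac ν w).1 ⟨hw, hνw⟩]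
    exact hdA μ ν w hw hμw
  refine ⟨fun ν κ z => ?_, fun μ ν z => ?_, fun μ z => ?_, fun κ z => (hval κ z).trans (conv1 z), fun ν κ z => ?_⟩
  · -- `D*_ν Ã_κ (z) = Ã_κ(z − e_ν) − Ã_κ(z)`
    rw [covDstar_one_apply]
    by_cases hz : η < len z
    · obtain ⟨hzS, hst⟩ := hS2 z hz
      have h1 := (hst ν).2.1
      have h2 : shiftY i κ ((shiftY i ν).symm z) ∈ S := ((hst ν).2.2 κ).2.1
      have h3 : shiftY i κ z ∈ S := (hst κ).1
      have h := fine ν κ ((shiftY i ν).symm z) z h1 (by rw [Equiv.apply_symm_apply]; exact hzS) h2 (by rw [Equiv.apply_symm_apply]; exact h3)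
      rw [Equiv.apply_symm_apply] at h
      rw [← norm_neg, ← smul_neg, neg_sub]
      exact h.trans (conv2 z)
    · exact crude z _ _ hz (hval _ _) (hval _ _)
  · -- `D_μ Ã_ν (z) = Ã_ν(z + e_μ) − Ã_ν(z)`
    rw [covD_one_apply]
    by_cases hz : η < len z
    · obtain ⟨hzS, hst⟩ := hS2 z hz
      exact (fine μ ν z z hzS (hst μ).1 (hst ν).1 ((hst μ).2.2 ν).1).trans (conv2 z)
    · exact crude z _ _ hz (hval _ _) (hval _ _)
  · -- `D*_μ τ*_μ Ã_μ (z) = Ã_μ(z − 2e_μ) − Ã_μ(z − e_μ)`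
    rw [covDstar_one_apply, tauB_one_apply, tauB_one_apply]
    by_cases hz : η < len z
    · obtain ⟨hzS, hst⟩ := hS2 z hz
      have h1 : (shiftY i μ).symm ((shiftY i μ).symm z) ∈ S := ((hst μ).2.2 μ).2.2
      have h2 : (shiftY i μ).symm z ∈ S := (hst μ).2.1
      have h := fine μ μ ((shiftY i μ).symm ((shiftY i μ).symm z)) z h1 (by rw [Equiv.apply_symm_apply]; exact h2)
        (by rw [Equiv.apply_symm_apply]; exact h2) (by rw [Equiv.apply_symm_apply, Equiv.apply_symm_apply]; exact hzS)
      rw [Equiv.apply_symm_apply] at h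
      rw [← norm_neg, ← smul_neg, neg_sub]
      exact h.trans (conv2 z)
    · exact crude z _ _ hz (hval _ _) (hval _ _)
  · rw [tauB_one_apply]; exact (hval κ _).trans (conv1 z)

omit [CompleteSpace 𝔸] in
/-- ★★ **THE SAME FOR THE CUT FIELD `cutFldS i S A` READ ON THE CHART** (`chartA i (cutFldS i S A) = cutAc i S (chartA i A)`), with the datum in its V1 form on a set `Q`
containing the chart preimage of `S`. [cite: Balaban1985BackgroundPropagators, (3.37) p.396, Cor. 3.6 p.408, (3.35) p.396] -/
theorem readings337_cutFldS {S : Finset (SiteY i)} {A : AfldY 𝔸 i} {Q : Set (Site (PV d ℓ i.m i.K hd hL) 0)} {C η ξ Λ : ℝ}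
    (hC : 0 ≤ C) (hη : 0 < η) (hξ : η ≤ ξ) (hΛ : 1 ≤ Λ) (hQ : ∀ z ∈ S, (boxEquiv i.hN).symm z ∈ Q)
    (hA : ∀ κ, ∀ x ∈ Q, ‖A κ x‖ ≤ C * ξ⁻¹)
    (hdA : ∀ μ ν, ∀ x ∈ Q, ‖((η : ℂ)⁻¹) • covD (shiftsV1 (PV d ℓ i.m i.K hd hL)) (fun _ _ => (1 : 𝔸ˣ)) μ (A ν) x‖ ≤ C * (ξ ^ 2)⁻¹)
    (len : SiteY i → ℝ) (hlenη : ∀ z, η ≤ len z) (hlenΛ : ∀ z, len z ≤ Λ * ξ)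
    (hS2 : ∀ z, η < len z → z ∈ S ∧ ∀ μ, shiftY i μ z ∈ S ∧ (shiftY i μ).symm z ∈ S ∧
      ∀ ν, shiftY i ν (shiftY i μ z) ∈ S ∧ shiftY i ν ((shiftY i μ).symm z) ∈ S ∧ (shiftY i ν).symm ((shiftY i μ).symm z) ∈ S) :
    (∀ ν κ z, ‖((η : ℂ)⁻¹) • covDstar (shiftY i) (fun _ _ => (1 : 𝔸ˣ)) ν (chartA i (cutFldS i S A) κ) z‖ ≤ 2 * C * Λ ^ 2 * (len z ^ 2)⁻¹) ∧
    (∀ μ ν z, ‖((η : ℂ)⁻¹) • covD (shiftY i) (fun _ _ => (1 : 𝔸ˣ)) μ (chartA i (cutFldS i S A) ν) z‖ ≤ 2 * C * Λ ^ 2 * (len z ^ 2)⁻¹) ∧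
    (∀ μ z, ‖((η : ℂ)⁻¹) • covDstar (shiftY i) (fun _ _ => (1 : 𝔸ˣ)) μ
        (tauB (shiftY i) (fun _ _ => (1 : 𝔸ˣ)) μ (chartA i (cutFldS i S A) μ)) z‖ ≤ 2 * C * Λ ^ 2 * (len z ^ 2)⁻¹) ∧
    (∀ κ z, ‖chartA i (cutFldS i S A) κ z‖ ≤ 2 * C * Λ ^ 2 * (len z)⁻¹) ∧
    (∀ ν κ z, ‖tauB (shiftY i) (fun _ _ => (1 : 𝔸ˣ)) ν (chartA i (cutFldS i S A) κ) z‖ ≤ 2 * C * Λ ^ 2 * (len z)⁻¹) := by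
  rw [chartA_cutFldS]
  refine readings337_cutAc i hC hη hξ hΛ (fun κ z hz => ?_) (fun μ ν z hz hz' => ?_) len hlenη hlenΛ hS2
  · rw [chartA_apply]; exact hA κ _ (hQ z hz)
  · have h := hdA μ ν _ (hQ z hz)
    rw [← B9Cor36CutoffField337.covD_one_chartA, covD_one_apply] at h
    exact h

end Readings

end Literature.MathematicalPhysics.QuantumFieldTheory.Balaban1983to89.B9Eq337CutFieldDirY

end
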